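/-
Origin: expansion seat `planner-pub-hodgecm-pv14-g4-0`, handover #1 2026-08-18T08:29:38Z (`HOME/pub-hodgecm-pv14-g4/lean/Pv14g4/SchwartzTranslation.lean`, md5 4e9574a3, 363 lines);
landed by the gen-7 packager in gate run 27 as `HodgeCM/Automorphic/SchwartzTranslation.lean` (verbatim).
-/
/-
Origin: HOME/pub-hodgecm-pv14-g4/lean/Pv14g4/SchwartzTranslation.lean — session planner-pub-hodgecm-pv14-g4-0
(unit pub-hodgecm-pv14-g4, DAG-NODE PROVER #14 gen 4; lineage pv14 → pv14-g2 → pv14-g3 → pv14-g4).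
Intended final place (packager's call): `HodgeCM/Automorphic/SchwartzTranslation.lean`.
NEW ADDITIVE LEAF: imports landed tree modules only (`HodgeCM.PerL34.LatticeTheta`, pv11-g2) + Mathlib; no rewrite.
KIND: KERNEL — Mathlib-only analysis; nothing cited, nothing posited.
-/
import Mathlib.Analysis.Distribution.SchwartzSpace.Basic
import Mathlib.Analysis.Calculus.MeanValue
import Summits.HodgeConjecture.HodgeCM.PerL34.LatticeTheta

/-!
# Schwartz-space analysis for the archimedean Schrödinger–lattice theta model

Three Mathlib-only facts about Mathlib's Schwartz space `𝓢(E, F)` (`E` a real normed space, `F` a real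
normed space), used by `WeilThetaModelSchrodinger` to INHABIT prl1-g4's `HodgeCM.WeilThetaModel` honestly:

* §1 `norm_iteratedFDeriv_le_supSeminorm` — polynomial decay with the EXPLICIT seminorm constant
  `‖Dⁿ f (y)‖ ≤ 2ᵏ · supSeminorm k n f · (1 + ‖y‖)⁻ᵏ` (Mathlib's `one_add_le_sup_seminorm_apply`, inverted);
* §2 **the theta distribution is a continuous linear functional**: for a discrete `ℤ`-lattice `L ⊆ E`
  (`E` finite-dimensional, `F` complete) and `x : E`, `thetaCLM L x : 𝓢(E, F) →L[ℝ] F`,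
  `thetaCLM L x f = ∑' v : L, f (x + v)` (`SchwartzMap.mkCLMtoNormedSpace` with the bound
  `‖∑_v f (x + v)‖ ≤ 2ᵏ (1 + ‖x‖)ᵏ (∑_v (1 + ‖v‖)⁻ᵏ) · supSeminorm k 0 f`, `k = rank L + 1`, from pv11-g2's
  Peetre–Schwartz majorant `HodgeCM.PerL34.LatticeTheta`) — this is the field `dist_cont` of `WeilThetaModel`
  ("the theta distribution `Φ ↦ Θ_Φ(1)` is continuous", PerL v5 l. 343, We64 p. 194) in the Schrödinger–lattice
  dictionary, as a KERNEL THEOREM;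
* §3 **translation is jointly continuous** on the Schwartz space:
  `Continuous fun p : E × 𝓢(E, F) => SchwartzMap.compSubConstCLM 𝕜 p.1 p.2` (`(a, f) ↦ f (· - a)`), from the
  equicontinuity bound `p_{k,n}(τ_a f) ≤ 2ᵏ (1 + ‖a‖)ᵏ supSeminorm k n f` (Peetre) and the strong-continuity bound
  `p_{k,n}(τ_a f - τ_b f) ≤ 2ᵏ (1 + ‖a‖ + ‖b‖)ᵏ supSeminorm k (n+1) f · ‖a - b‖` (mean-value inequality on
  `iteratedFDeriv ℝ n f` over the segment `[x - b, x - a]`) — this is We64 n° 39 ("`(S, Φ) ↦ SΦ` est continue")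
  for the translation part of the Heisenberg group in the Schrödinger model, as a KERNEL THEOREM;
  §4 combines §2 and §3: `(x, f) ↦ ∑_v f (x + v)` is jointly continuous.

No axiom, no cited fact; every declaration closes on the standard trio.
-/

set_option autoImplicit false

noncomputable section

open Filter Topology Set
open scoped SchwartzMap

namespace HodgeCM
namespace SchwartzWeil

/-! ## 1. Decay with the explicit seminorm constant -/

section Decay

variable {E F : Type*} [NormedAddCommGroup E] [NormedSpace ℝ E]
  [NormedAddCommGroup F] [NormedSpace ℝ F]

/-- The block sup-seminorm `sup_{k' ≤ k, n' ≤ n} p_{k',n'}` of the Schwartz family (itself a seminorm). -/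
abbrev supSeminorm (k n : ℕ) : Seminorm ℝ 𝓢(E, F) :=
  (Finset.Iic (k, n)).sup (schwartzSeminormFamily ℝ E F)

/-- (Ported verbatim from the HodgeCMPerL package; no docstring in the source.) -/
theorem supSeminorm_nonneg (k n : ℕ) (f : 𝓢(E, F)) : 0 ≤ supSeminorm k n f :=
  apply_nonneg _ _

/-- Mathlib's `one_add_le_sup_seminorm_apply`, restated with `supSeminorm`. -/
theorem one_add_pow_mul_norm_iteratedFDeriv_le (k n : ℕ) (f : 𝓢(E, F)) (y : E) :
    (1 + ‖y‖) ^ k * ‖iteratedFDeriv ℝ n f y‖ ≤ 2 ^ k * supSeminorm k n f :=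
  SchwartzMap.one_add_le_sup_seminorm_apply (𝕜 := ℝ) (m := (k, n)) (k := k) (n := n) le_rfl le_rfl f y

/-- Polynomial decay of all derivatives with the explicit constant `2ᵏ · supSeminorm k n f`. -/
theorem norm_iteratedFDeriv_le_supSeminorm (k n : ℕ) (f : 𝓢(E, F)) (y : E) :
    ‖iteratedFDeriv ℝ n f y‖ ≤ 2 ^ k * supSeminorm k n f * (1 + ‖y‖)⁻¹ ^ k := by
  have h := one_add_pow_mul_norm_iteratedFDeriv_le k n f y
  have hy : (0 : ℝ) < (1 + ‖y‖) ^ k := by positivity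
  rw [inv_pow, ← div_eq_mul_inv, le_div_iff₀ hy, mul_comm]
  exact h

/-- Polynomial decay of the values with the explicit constant. -/
theorem norm_le_supSeminorm (k : ℕ) (f : 𝓢(E, F)) (y : E) :
    ‖f y‖ ≤ 2 ^ k * supSeminorm k 0 f * (1 + ‖y‖)⁻¹ ^ k := by
  simpa [norm_iteratedFDeriv_zero] using norm_iteratedFDeriv_le_supSeminorm k 0 f y

/-- The Peetre–Schwartz majorant with the explicit constant:
`‖f (x + w)‖ ≤ 2ᵏ · supSeminorm k 0 f · (1 + ‖x‖)ᵏ · (1 + ‖w‖)⁻ᵏ`. -/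
theorem norm_translate_le_supSeminorm (k : ℕ) (f : 𝓢(E, F)) (x w : E) :
    ‖f (x + w)‖ ≤ 2 ^ k * supSeminorm k 0 f * (1 + ‖x‖) ^ k * (1 + ‖w‖)⁻¹ ^ k := by
  refine (norm_le_supSeminorm k f (x + w)).trans ?_
  rw [mul_assoc (2 ^ k * supSeminorm k 0 f)]
  exact mul_le_mul_of_nonneg_left (PerL34.LatticeTheta.inv_one_add_norm_add_pow_le x w k)
    (mul_nonneg (by positivity) (supSeminorm_nonneg k 0 f))

end Decay

/-! ## 2. The theta distribution of a discrete lattice is a continuous linear functional -/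

section ThetaDistribution

variable {E F : Type*} [NormedAddCommGroup E] [NormedSpace ℝ E] [FiniteDimensional ℝ E]
  [NormedAddCommGroup F] [NormedSpace ℝ F]
  (L : Submodule ℤ E) [DiscreteTopology L]

/-- The decay exponent used over the lattice: `rank L + 1` (so that `∑_v (1 + ‖v‖)⁻ᵏ` converges). -/
abbrev decayExp : ℕ := Module.finrank ℤ L + 1

/-- The lattice constant `∑_{v ∈ L} (1 + ‖v‖)^{-(rank L + 1)}` (a convergent series). -/
def latticeConst : ℝ := ∑' v : L, (1 + ‖(v : E)‖)⁻¹ ^ decayExp L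

/-- (Ported verbatim from the HodgeCMPerL package; no docstring in the source.) -/
theorem summable_latticeConst : Summable fun v : L => (1 + ‖(v : E)‖)⁻¹ ^ decayExp L :=
  PerL34.LatticeTheta.summable_inv_one_add_norm_pow L (Nat.lt_succ_self _)

omit [NormedSpace ℝ E] [FiniteDimensional ℝ E] [DiscreteTopology L] in
/-- (Ported verbatim from the HodgeCMPerL package; no docstring in the source.) -/
theorem latticeConst_nonneg : 0 ≤ latticeConst L :=
  tsum_nonneg fun _ => by positivity

/-- **Uniform bound for the theta series by one Schwartz seminorm block**:
`‖∑_{v ∈ L} f (x + v)‖ ≤ 2ᵏ (1 + ‖x‖)ᵏ · latticeConst L · supSeminorm k 0 f`, `k = rank L + 1`. -/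
theorem norm_tsum_translate_le (f : 𝓢(E, F)) (x : E) :
    ‖∑' v : L, f (x + (v : E))‖ ≤
      (2 ^ decayExp L * (1 + ‖x‖) ^ decayExp L * latticeConst L) * supSeminorm (decayExp L) 0 f := by
  set k := decayExp L with hk
  set S : ℝ := supSeminorm k 0 f with hS
  have hS0 : 0 ≤ S := supSeminorm_nonneg k 0 f
  have hsum := summable_latticeConst L
  have hnorm := PerL34.LatticeTheta.summable_norm_translate L f x
  calc ‖∑' v : L, f (x + (v : E))‖ ≤ ∑' v : L, ‖f (x + (v : E))‖ := norm_tsum_le_tsum_norm hnorm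
    _ ≤ ∑' v : L, 2 ^ k * S * (1 + ‖x‖) ^ k * (1 + ‖(v : E)‖)⁻¹ ^ k :=
        hnorm.tsum_le_tsum (fun v => norm_translate_le_supSeminorm k f x v) (hsum.mul_left _)
    _ = 2 ^ k * S * (1 + ‖x‖) ^ k * latticeConst L := by rw [tsum_mul_left]; rfl
    _ = (2 ^ k * (1 + ‖x‖) ^ k * latticeConst L) * S := by ring

variable [CompleteSpace F]

/-- **The theta distribution** `f ↦ ∑_{v ∈ L} f (x + v)` as a CONTINUOUS LINEAR functional on the Schwartz space
(the kernel form of `WeilThetaModel.dist_cont` in the Schrödinger–lattice dictionary). -/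
def thetaCLM (x : E) : 𝓢(E, F) →L[ℝ] F :=
  SchwartzMap.mkCLMtoNormedSpace (𝕜 := ℝ) (𝕜' := ℝ) (σ := RingHom.id ℝ)
    (fun f => ∑' v : L, f (x + (v : E)))
    (fun f g => by
      simpa using
        (PerL34.LatticeTheta.summable_translate L f x).tsum_add (PerL34.LatticeTheta.summable_translate L g x))
    (fun a f => by
      simpa using
        (PerL34.LatticeTheta.summable_translate L f x).tsum_const_smul a)
    ⟨Finset.Iic (decayExp L, 0), 2 ^ decayExp L * (1 + ‖x‖) ^ decayExp L * latticeConst L,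
      mul_nonneg (by positivity) (latticeConst_nonneg L), fun f => norm_tsum_translate_le L f x⟩

/-- (Ported verbatim from the HodgeCMPerL package; no docstring in the source.) -/
@[simp] theorem thetaCLM_apply (x : E) (f : 𝓢(E, F)) :
    thetaCLM L x f = ∑' v : L, f (x + (v : E)) := rfl

/-- `dist_cont` in kernel form: `f ↦ ∑_{v ∈ L} f (x + v)` is continuous on `𝓢(E, F)`. -/
theorem continuous_tsum_translate_schwartz (x : E) :
    Continuous fun f : 𝓢(E, F) => ∑' v : L, f (x + (v : E)) :=
  (thetaCLM L x).continuous

/-- The special case `x = 0`: `f ↦ ∑_{v ∈ L} f v` is a continuous linear functional. -/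
theorem continuous_tsum_restrict_schwartz :
    Continuous fun f : 𝓢(E, F) => ∑' v : L, f (v : E) := by
  simpa using continuous_tsum_translate_schwartz L (0 : E)

end ThetaDistribution

/-! ## 3. Translation is jointly continuous on the Schwartz space -/

section Translation

variable (𝕜 : Type*) [RCLike 𝕜]
variable {E F : Type*} [NormedAddCommGroup E] [NormedSpace ℝ E]
  [NormedAddCommGroup F] [NormedSpace ℝ F] [NormedSpace 𝕜 F]

/-- (Ported verbatim from the HodgeCMPerL package; no docstring in the source.) -/
theorem coe_compSubConstCLM (a : E) (f : 𝓢(E, F)) :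
    ⇑(SchwartzMap.compSubConstCLM 𝕜 a f) = fun z => f (z - a) := rfl

/-- (Ported verbatim from the HodgeCMPerL package; no docstring in the source.) -/
theorem iteratedFDeriv_compSubConstCLM (n : ℕ) (a : E) (f : 𝓢(E, F)) (x : E) :
    iteratedFDeriv ℝ n (SchwartzMap.compSubConstCLM 𝕜 a f) x = iteratedFDeriv ℝ n f (x - a) := by
  rw [coe_compSubConstCLM, iteratedFDeriv_comp_sub]

/-- **Equicontinuity of translations on bounded sets**: each Schwartz seminorm of `τ_a f = f (· - a)` is bounded
by `2ᵏ (1 + ‖a‖)ᵏ` times a fixed seminorm block of `f` (Peetre's inequality). -/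
theorem seminorm_compSubConstCLM_le (k n : ℕ) (a : E) (f : 𝓢(E, F)) :
    SchwartzMap.seminorm ℝ k n (SchwartzMap.compSubConstCLM 𝕜 a f) ≤
      2 ^ k * (1 + ‖a‖) ^ k * supSeminorm k n f := by
  refine SchwartzMap.seminorm_le_bound ℝ k n _
    (mul_nonneg (by positivity) (supSeminorm_nonneg k n f)) fun x => ?_
  rw [iteratedFDeriv_compSubConstCLM]
  have hP : 1 + ‖x‖ ≤ (1 + ‖a‖) * (1 + ‖x - a‖) := by
    simpa [norm_neg, neg_add_eq_sub] using PerL34.LatticeTheta.one_add_norm_le_mul (-a) x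
  calc ‖x‖ ^ k * ‖iteratedFDeriv ℝ n f (x - a)‖
      ≤ (1 + ‖x‖) ^ k * ‖iteratedFDeriv ℝ n f (x - a)‖ := by
        gcongr; exact le_add_of_nonneg_left zero_le_one
    _ ≤ ((1 + ‖a‖) * (1 + ‖x - a‖)) ^ k * ‖iteratedFDeriv ℝ n f (x - a)‖ := by gcongr
    _ = (1 + ‖a‖) ^ k * ((1 + ‖x - a‖) ^ k * ‖iteratedFDeriv ℝ n f (x - a)‖) := by
        rw [mul_pow]; ring
    _ ≤ (1 + ‖a‖) ^ k * (2 ^ k * supSeminorm k n f) :=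
        mul_le_mul_of_nonneg_left (one_add_pow_mul_norm_iteratedFDeriv_le k n f (x - a)) (by positivity)
    _ = 2 ^ k * (1 + ‖a‖) ^ k * supSeminorm k n f := by ring

/-- **Strong continuity of translation, quantitatively**: the mean-value inequality on `iteratedFDeriv ℝ n f`
over the segment `[x - b, x - a]` with the Peetre–Schwartz decay of `iteratedFDeriv ℝ (n+1) f` gives
`p_{k,n}(τ_a f - τ_b f) ≤ 2ᵏ (1 + ‖a‖ + ‖b‖)ᵏ · supSeminorm k (n+1) f · ‖a - b‖`. -/
theorem seminorm_compSubConstCLM_sub_le (k n : ℕ) (a b : E) (f : 𝓢(E, F)) :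
    SchwartzMap.seminorm ℝ k n (SchwartzMap.compSubConstCLM 𝕜 a f - SchwartzMap.compSubConstCLM 𝕜 b f) ≤
      2 ^ k * (1 + (‖a‖ + ‖b‖)) ^ k * supSeminorm k (n + 1) f * ‖a - b‖ := by
  set S : ℝ := supSeminorm k (n + 1) f with hS
  have hS0 : 0 ≤ S := supSeminorm_nonneg k (n + 1) f
  refine SchwartzMap.seminorm_le_bound ℝ k n _ (by positivity) fun x => ?_
  -- the `n`-th derivative of the difference
  have hD : iteratedFDeriv ℝ n
      (⇑(SchwartzMap.compSubConstCLM 𝕜 a f - SchwartzMap.compSubConstCLM 𝕜 b f)) x =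
      iteratedFDeriv ℝ n f (x - a) - iteratedFDeriv ℝ n f (x - b) := by
    have hcoe : ⇑(SchwartzMap.compSubConstCLM 𝕜 a f - SchwartzMap.compSubConstCLM 𝕜 b f) =
        ⇑(SchwartzMap.compSubConstCLM 𝕜 a f) - ⇑(SchwartzMap.compSubConstCLM 𝕜 b f) := rfl
    rw [hcoe, iteratedFDeriv_sub_apply ((SchwartzMap.compSubConstCLM 𝕜 a f).contDiffAt n)
      ((SchwartzMap.compSubConstCLM 𝕜 b f).contDiffAt n), iteratedFDeriv_compSubConstCLM,
      iteratedFDeriv_compSubConstCLM]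
  rw [hD]
  -- mean-value inequality for `g := iteratedFDeriv ℝ n f` on the segment `[x - b, x - a]`
  set g : E → (E [×n]→L[ℝ] F) := iteratedFDeriv ℝ n f with hg
  have hg_diff : Differentiable ℝ g :=
    (f.smooth (n + 1)).differentiable_iteratedFDeriv (by exact_mod_cast Nat.lt_succ_self n)
  set B : ℝ := 2 ^ k * S * ((1 + (‖a‖ + ‖b‖)) ^ k * (1 + ‖x‖)⁻¹ ^ k) with hB
  have hball : segment ℝ (x - b) (x - a) ⊆ Metric.closedBall x (‖a‖ + ‖b‖) := by
    refine (convex_closedBall x (‖a‖ + ‖b‖)).segment_subset ?_ ?_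
    · simp only [Metric.mem_closedBall, dist_eq_norm, sub_sub_cancel_left, norm_neg]
      exact le_add_of_nonneg_left (norm_nonneg a)
    · simp only [Metric.mem_closedBall, dist_eq_norm, sub_sub_cancel_left, norm_neg]
      exact le_add_of_nonneg_right (norm_nonneg b)
  have hbound : ∀ ξ ∈ segment ℝ (x - b) (x - a), ‖fderiv ℝ g ξ‖ ≤ B := by
    intro ξ hξ
    have hξx : ‖ξ - x‖ ≤ ‖a‖ + ‖b‖ := by
      simpa only [Metric.mem_closedBall, dist_eq_norm] using hball hξ
    have hPeetre : (1 + ‖ξ‖)⁻¹ ^ k ≤ (1 + ‖ξ - x‖) ^ k * (1 + ‖x‖)⁻¹ ^ k := by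
      simpa only [sub_add_cancel] using PerL34.LatticeTheta.inv_one_add_norm_add_pow_le (ξ - x) x k
    rw [hg, norm_fderiv_iteratedFDeriv]
    calc ‖iteratedFDeriv ℝ (n + 1) f ξ‖ ≤ 2 ^ k * S * (1 + ‖ξ‖)⁻¹ ^ k :=
          norm_iteratedFDeriv_le_supSeminorm k (n + 1) f ξ
      _ ≤ 2 ^ k * S * ((1 + ‖ξ - x‖) ^ k * (1 + ‖x‖)⁻¹ ^ k) := by gcongr
      _ ≤ 2 ^ k * S * ((1 + (‖a‖ + ‖b‖)) ^ k * (1 + ‖x‖)⁻¹ ^ k) := by gcongr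
  have hMVT : ‖g (x - a) - g (x - b)‖ ≤ B * ‖(x - a) - (x - b)‖ :=
    (convex_segment (x - b) (x - a)).norm_image_sub_le_of_norm_fderiv_le
      (fun ξ _ => hg_diff.differentiableAt) hbound (left_mem_segment ℝ _ _) (right_mem_segment ℝ _ _)
  have hab : ‖(x - a) - (x - b)‖ = ‖a - b‖ := by
    rw [sub_sub_sub_cancel_left, norm_sub_rev]
  rw [hab] at hMVT
  have hx1 : (0 : ℝ) < 1 + ‖x‖ := by positivity
  calc ‖x‖ ^ k * ‖g (x - a) - g (x - b)‖ ≤ (1 + ‖x‖) ^ k * (B * ‖a - b‖) := by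
        gcongr; exact le_add_of_nonneg_left zero_le_one
    _ = 2 ^ k * (1 + (‖a‖ + ‖b‖)) ^ k * S * ‖a - b‖ * ((1 + ‖x‖) ^ k * (1 + ‖x‖)⁻¹ ^ k) := by
        rw [hB]; ring
    _ = 2 ^ k * (1 + (‖a‖ + ‖b‖)) ^ k * S * ‖a - b‖ := by
        have hxk : (1 + ‖x‖) ^ k * (1 + ‖x‖)⁻¹ ^ k = 1 := by
          rw [← mul_pow, mul_inv_cancel₀ hx1.ne', one_pow]
        rw [hxk, mul_one]

/-- **Joint continuity of translation on the Schwartz space** (We64 n° 39 for the translation part of the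
Heisenberg group in the Schrödinger model, as a kernel theorem):
`(a, f) ↦ f (· - a)` is continuous `E × 𝓢(E, F) → 𝓢(E, F)`. -/
theorem continuous_compSubConstCLM_uncurry :
    Continuous fun p : E × 𝓢(E, F) => SchwartzMap.compSubConstCLM 𝕜 p.1 p.2 := by
  have hW := schwartz_withSeminorms ℝ E F
  rw [continuous_iff_continuousAt]
  rintro ⟨a₀, f₀⟩
  refine (hW.tendsto_nhds _ _).2 ?_
  rintro ⟨k, n⟩ ε hε
  -- constants
  set A : ℝ := 2 ^ k * (2 + ‖a₀‖) ^ k with hA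
  have hA0 : 0 < A := by positivity
  set M : ℝ := 2 ^ k * (1 + ((‖a₀‖ + 1) + ‖a₀‖)) ^ k * supSeminorm k (n + 1) f₀ with hM
  have hM0 : 0 ≤ M := mul_nonneg (by positivity) (supSeminorm_nonneg k (n + 1) f₀)
  -- the two smallness conditions
  have ha : ∀ᶠ p : E × 𝓢(E, F) in 𝓝 (a₀, f₀), ‖p.1 - a₀‖ < min 1 (ε / 2 / (M + 1)) := by
    have h : ∀ᶠ a in 𝓝 a₀, ‖a - a₀‖ < min 1 (ε / 2 / (M + 1)) := by
      have hr : 0 < min 1 (ε / 2 / (M + 1)) := lt_min one_pos (by positivity)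
      filter_upwards [Metric.ball_mem_nhds a₀ hr] with a ha
      rwa [Metric.mem_ball, dist_eq_norm] at ha
    exact (continuous_fst.tendsto (a₀, f₀)).eventually h
  have hf : ∀ᶠ p : E × 𝓢(E, F) in 𝓝 (a₀, f₀), supSeminorm k n (p.2 - f₀) < ε / 2 / A := by
    have h := (hW.tendsto_nhds' (fun p : E × 𝓢(E, F) => p.2) f₀).1 (continuous_snd.tendsto (a₀, f₀))
      (Finset.Iic (k, n)) (ε / 2 / A) (by positivity)
    exact h
  filter_upwards [ha, hf] with p hpa hpf
  obtain ⟨a, f⟩ := p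
  simp only at hpa hpf ⊢
  have ha1 : ‖a - a₀‖ < 1 := lt_of_lt_of_le hpa (min_le_left _ _)
  have ha2 : ‖a - a₀‖ ≤ ε / 2 / (M + 1) := (lt_of_lt_of_le hpa (min_le_right _ _)).le
  have hna : ‖a‖ ≤ ‖a₀‖ + 1 := by
    have := norm_le_norm_add_norm_sub' a a₀  -- ‖a‖ ≤ ‖a₀‖ + ‖a - a₀‖
    linarith
  -- split `τ_a f - τ_{a₀} f₀ = τ_a (f - f₀) + (τ_a f₀ - τ_{a₀} f₀)`
  have hsplit : SchwartzMap.compSubConstCLM 𝕜 a f - SchwartzMap.compSubConstCLM 𝕜 a₀ f₀ =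
      SchwartzMap.compSubConstCLM 𝕜 a (f - f₀) +
        (SchwartzMap.compSubConstCLM 𝕜 a f₀ - SchwartzMap.compSubConstCLM 𝕜 a₀ f₀) := by
    rw [map_sub]; abel
  have h1 : SchwartzMap.seminorm ℝ k n (SchwartzMap.compSubConstCLM 𝕜 a (f - f₀)) < ε / 2 := by
    calc SchwartzMap.seminorm ℝ k n (SchwartzMap.compSubConstCLM 𝕜 a (f - f₀))
        ≤ 2 ^ k * (1 + ‖a‖) ^ k * supSeminorm k n (f - f₀) := seminorm_compSubConstCLM_le 𝕜 k n a _
      _ ≤ A * supSeminorm k n (f - f₀) := by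
          apply mul_le_mul_of_nonneg_right _ (supSeminorm_nonneg k n _)
          rw [hA]
          gcongr 2 ^ k * ?_ ^ k
          linarith
      _ < A * (ε / 2 / A) := by gcongr
      _ = ε / 2 := by field_simp
  have h2 : SchwartzMap.seminorm ℝ k n
      (SchwartzMap.compSubConstCLM 𝕜 a f₀ - SchwartzMap.compSubConstCLM 𝕜 a₀ f₀) ≤ ε / 2 := by
    calc SchwartzMap.seminorm ℝ k n
          (SchwartzMap.compSubConstCLM 𝕜 a f₀ - SchwartzMap.compSubConstCLM 𝕜 a₀ f₀)
        ≤ 2 ^ k * (1 + (‖a‖ + ‖a₀‖)) ^ k * supSeminorm k (n + 1) f₀ * ‖a - a₀‖ :=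
          seminorm_compSubConstCLM_sub_le 𝕜 k n a a₀ f₀
      _ ≤ M * ‖a - a₀‖ := by
          apply mul_le_mul_of_nonneg_right _ (norm_nonneg _)
          rw [hM]
          apply mul_le_mul_of_nonneg_right _ (supSeminorm_nonneg k (n + 1) f₀)
          gcongr
      _ ≤ M * (ε / 2 / (M + 1)) := by gcongr
      _ ≤ ε / 2 := by
          rw [mul_div_assoc']
          rw [div_le_iff₀ (by positivity : (0 : ℝ) < M + 1)]
          nlinarith
  calc SchwartzMap.seminorm ℝ k n
        (SchwartzMap.compSubConstCLM 𝕜 a f - SchwartzMap.compSubConstCLM 𝕜 a₀ f₀)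
      = SchwartzMap.seminorm ℝ k n (SchwartzMap.compSubConstCLM 𝕜 a (f - f₀) +
          (SchwartzMap.compSubConstCLM 𝕜 a f₀ - SchwartzMap.compSubConstCLM 𝕜 a₀ f₀)) := by rw [hsplit]
    _ ≤ SchwartzMap.seminorm ℝ k n (SchwartzMap.compSubConstCLM 𝕜 a (f - f₀)) +
          SchwartzMap.seminorm ℝ k n
            (SchwartzMap.compSubConstCLM 𝕜 a f₀ - SchwartzMap.compSubConstCLM 𝕜 a₀ f₀) :=
        map_add_le_add _ _ _
    _ < ε / 2 + ε / 2 := add_lt_add_of_lt_of_le h1 h2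
    _ = ε := by ring

/-- Curried form: for fixed `f`, `a ↦ f (· - a)` is continuous `E → 𝓢(E, F)` (strong continuity). -/
theorem continuous_compSubConstCLM_left (f : 𝓢(E, F)) :
    Continuous fun a : E => SchwartzMap.compSubConstCLM 𝕜 a f :=
  (continuous_compSubConstCLM_uncurry 𝕜).comp (Continuous.prodMk_left f)

end Translation

/-! ## 4. Joint continuity of the theta function in the pair (translation, test function) -/

section ThetaJoint

variable {E F : Type*} [NormedAddCommGroup E] [NormedSpace ℝ E] [FiniteDimensional ℝ E]
  [NormedAddCommGroup F] [NormedSpace ℝ F] [CompleteSpace F]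
  (L : Submodule ℤ E) [DiscreteTopology L]

/-- `∑_{v ∈ L} f (x + v) = thetaCLM L 0 (f (· - (-x)))`: the theta series at `x` is the theta distribution at `0`
of the translate. -/
theorem tsum_translate_eq_thetaCLM_compSubConstCLM (f : 𝓢(E, F)) (x : E) :
    ∑' v : L, f (x + (v : E)) = thetaCLM L 0 (SchwartzMap.compSubConstCLM ℝ (-x) f) := by
  simp only [thetaCLM_apply, SchwartzMap.compSubConstCLM_apply, zero_add, sub_neg_eq_add, add_comm x]

/-- **Joint continuity** of `(x, f) ↦ ∑_{v ∈ L} f (x + v)` on `E × 𝓢(E, F)`. -/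
theorem continuous_tsum_translate_uncurry :
    Continuous fun p : E × 𝓢(E, F) => ∑' v : L, p.2 (p.1 + (v : E)) := by
  have h : (fun p : E × 𝓢(E, F) => ∑' v : L, p.2 (p.1 + (v : E))) =
      fun p => thetaCLM L 0 (SchwartzMap.compSubConstCLM ℝ (-p.1) p.2) := by
    funext p; exact tsum_translate_eq_thetaCLM_compSubConstCLM L p.2 p.1
  rw [h]
  exact (thetaCLM L 0).continuous.comp
    ((continuous_compSubConstCLM_uncurry ℝ).comp (continuous_fst.neg.prodMk continuous_snd))

end ThetaJoint

end SchwartzWeil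
end HodgeCM

end
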